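import Summits.CriticalPhenomena.PercolationContinuityZ3.Theorems.PercNearOneGluingNoHeavyLowerTailSahiCombTriangleSections
import Summits.CriticalPhenomena.PercolationContinuityZ3.Theorems.PercNearOneGluingNoHeavyLowerTailSahiCombFiveUpSetProduct

/-!
# The comb hierarchy for Sahi's `E_k`: the thin-edge LATTICE `Set ↥P × Set ↥Q` — re-indexing, signed counts, the five-up-set inequality
# on `Set β × Set γ`, and the up-set families (generic inputs of `…SahiCombTriangleThinEdge`)

Support file of the one-cut programme (crux `NoHeavyLowerTail`, stmt-CriticalPhenomena-4575; cell `prim-masterthm`, seat P5 gen 8;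
report `P5-LORENTZIAN-TEST.md` §13).  Bookkeeping for the thin-edge theorem, kept apart for size:

* `SahiHybrid.image_val_compl`, `sum_subsets_eq_sum_image`, `sum_subsets_prod` — sums over the subsets of `P` (and of `P`, `Q`) are sums over
  `Set ↥P` (resp. the lattice `Set ↥P × Set ↥Q`), complements inside the block becoming complements of the lattice;
* `SahiHybrid.sum_ite_mul_ite_mul_ite`, `mem_image_of_involutive`, **`sum_tri_fixed_x`** — a TRI-shaped sum of products of indicators of
  finsets `H, F, F', G` and their images under an involution `τ` is the signed count
  `2#(H∩F∩G) − #(H∩τF'∩G) − #(H∩F'∩τG) − #(H∩τF∩τG) + #(H∩τF'∩τG)`;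
* `SahiHybrid.mem_finsetEquivSet_symm`, **`fiveUpSetIneqOn_setProd`** — the five-up-set inequality on `(Set β × Set γ, (compl, compl))` from the
  one-cube `FiveUpSet.FiveUpSetIneq`, by transport (`…SahiCombFiveUpSetProduct`) along `Set β × Set γ ≃o Finset β × Finset γ`;
* `SahiHybrid.isUpperSet_famH/famF/famG`, `famF_mono`, `famG_mono` — the thin-edge families of increasing events are up-sets, nested in `x`.
Everything here is proved; axioms standard.  HONEST LABEL: bookkeeping; nothing here is an inequality claim of ours. [this work]
-/

noncomputable section

open scoped Classical

namespace Summit.CriticalPhenomena.PercolationContinuityZ3.Theorems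

open Finset Function
open Literature.Combinatorics.Sahi2008
open SahiComb LatticeFiveUpSet

namespace SahiHybrid

variable {ι : Type} [Fintype ι]

/-! ### Re-indexing the free-block sums by the points of `Set ↥P` -/

omit [Fintype ι] in
/-- The image of the complement is the complement inside the block. [folklore] -/
theorem image_val_compl (P : Set ι) (y : Set ↥P) : Subtype.val '' yᶜ = P \ Subtype.val '' y := by
  rw [Set.image_compl_eq_range_sdiff_image Subtype.val_injective, Subtype.range_coe]

/-- A sum over the subsets of `P` is a sum over `Set ↥P`. [folklore] -/
theorem sum_subsets_eq_sum_image (P : Set ι) (Ψ : Set ι → ℝ) :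
    ∑ y ∈ univ.filter (fun y : Set ι => y ⊆ P), Ψ y = ∑ y' : Set ↥P, Ψ (Subtype.val '' y') := by
  symm
  refine Finset.sum_nbij' (fun y' => Subtype.val '' y') (fun y => Subtype.val ⁻¹' y) ?_ ?_ ?_ ?_ ?_
  · intro y' _
    rw [mem_filter]
    exact ⟨mem_univ _, Subtype.coe_image_subset P y'⟩
  · intro y _; exact mem_univ _
  · intro y' _; exact Set.preimage_image_eq _ Subtype.val_injective
  · intro y hy
    rw [mem_filter] at hy
    rw [Subtype.image_preimage_coe]
    exact Set.inter_eq_right.2 hy.2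
  · intro y' _; rfl

/-- The double sum over the subsets of `P` and of `Q` is a sum over the lattice `Set ↥P × Set ↥Q`. [folklore] -/
theorem sum_subsets_prod (P Q : Set ι) (Ψ : Set ι → Set ι → ℝ) :
    ∑ y ∈ univ.filter (fun y : Set ι => y ⊆ P), ∑ z ∈ univ.filter (fun z : Set ι => z ⊆ Q), Ψ y z
      = ∑ w : Set ↥P × Set ↥Q, Ψ (Subtype.val '' w.1) (Subtype.val '' w.2) := by
  rw [sum_subsets_eq_sum_image]
  simp_rw [sum_subsets_eq_sum_image Q]
  rw [← Fintype.sum_prod_type']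

/-! ### Indicators and counts -/

section Counts

variable {W : Type} [Fintype W] [DecidableEq W]

/-- A sum of a triple product of indicators is the cardinality of the triple intersection. [folklore] -/
theorem sum_ite_mul_ite_mul_ite (H A B : Finset W) :
    ∑ w, (if w ∈ H then (1 : ℝ) else 0) * ((if w ∈ A then (1 : ℝ) else 0) * (if w ∈ B then (1 : ℝ) else 0))
      = ((H ∩ A ∩ B).card : ℝ) := by
  have h : ∀ w, (if w ∈ H then (1 : ℝ) else 0) * ((if w ∈ A then (1 : ℝ) else 0) * (if w ∈ B then (1 : ℝ) else 0))
      = if w ∈ H ∩ A ∩ B then 1 else 0 := by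
    intro w
    simp only [mem_inter]
    split_ifs <;> simp_all
  simp_rw [h]
  rw [Finset.sum_boole, Finset.filter_mem_eq_inter, univ_inter]

omit [Fintype W] in
/-- Membership in the image under an involution. [folklore] -/
theorem mem_image_of_involutive (τ : W ≃ W) (hτ : ∀ w, τ (τ w) = w) (F : Finset W) (w : W) : w ∈ F.image τ ↔ τ w ∈ F := by
  rw [mem_image]
  constructor
  · rintro ⟨a, ha, rfl⟩; rw [hτ]; exact ha
  · intro h; exact ⟨τ w, h, hτ w⟩

/-- **The inner sum for fixed `x`, as signed counts**: with indicators of `H`, `F = F_x`, `F' = F_x̄`, `G = G_x` and their `τ`-images,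
`Σ_w [H](2[F][G] − [τF'][G] − [F'][τG] − [τF][τG] + [τF'][τG]) = 2#(H∩F∩G) − #(H∩τF'∩G) − #(H∩F'∩τG) − #(H∩τF∩τG) + #(H∩τF'∩τG)`. [this work] -/
theorem sum_tri_fixed_x (τ : W ≃ W) (hτ : ∀ w, τ (τ w) = w) (H F F' G : Finset W) :
    ∑ w, (if w ∈ H then (1 : ℝ) else 0) *
        (2 * (if w ∈ F then (1 : ℝ) else 0) * (if w ∈ G then (1 : ℝ) else 0)
          - (if τ w ∈ F' then (1 : ℝ) else 0) * (if w ∈ G then (1 : ℝ) else 0)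
          - (if w ∈ F' then (1 : ℝ) else 0) * (if τ w ∈ G then (1 : ℝ) else 0)
          - (if τ w ∈ F then (1 : ℝ) else 0) * (if τ w ∈ G then (1 : ℝ) else 0)
          + (if τ w ∈ F' then (1 : ℝ) else 0) * (if τ w ∈ G then (1 : ℝ) else 0))
      = 2 * ((H ∩ F ∩ G).card : ℝ) - ((H ∩ F'.image τ ∩ G).card : ℝ) - ((H ∩ F' ∩ G.image τ).card : ℝ)
          - ((H ∩ F.image τ ∩ G.image τ).card : ℝ) + ((H ∩ F'.image τ ∩ G.image τ).card : ℝ) := by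
  simp_rw [← mem_image_of_involutive τ hτ]
  have h : ∀ w, (if w ∈ H then (1 : ℝ) else 0) *
        (2 * (if w ∈ F then (1 : ℝ) else 0) * (if w ∈ G then (1 : ℝ) else 0)
          - (if w ∈ F'.image τ then (1 : ℝ) else 0) * (if w ∈ G then (1 : ℝ) else 0)
          - (if w ∈ F' then (1 : ℝ) else 0) * (if w ∈ G.image τ then (1 : ℝ) else 0)
          - (if w ∈ F.image τ then (1 : ℝ) else 0) * (if w ∈ G.image τ then (1 : ℝ) else 0)
          + (if w ∈ F'.image τ then (1 : ℝ) else 0) * (if w ∈ G.image τ then (1 : ℝ) else 0))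
      = 2 * ((if w ∈ H then (1 : ℝ) else 0) * ((if w ∈ F then (1 : ℝ) else 0) * (if w ∈ G then (1 : ℝ) else 0)))
        - (if w ∈ H then (1 : ℝ) else 0) * ((if w ∈ F'.image τ then (1 : ℝ) else 0) * (if w ∈ G then (1 : ℝ) else 0))
        - (if w ∈ H then (1 : ℝ) else 0) * ((if w ∈ F' then (1 : ℝ) else 0) * (if w ∈ G.image τ then (1 : ℝ) else 0))
        - (if w ∈ H then (1 : ℝ) else 0) * ((if w ∈ F.image τ then (1 : ℝ) else 0) * (if w ∈ G.image τ then (1 : ℝ) else 0))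
        + (if w ∈ H then (1 : ℝ) else 0) * ((if w ∈ F'.image τ then (1 : ℝ) else 0) * (if w ∈ G.image τ then (1 : ℝ) else 0)) := by
    intro w; ring
  simp_rw [h]
  simp only [sum_add_distrib, sum_sub_distrib, ← mul_sum, sum_ite_mul_ite_mul_ite]

end Counts

/-! ### The five-up-set inequality on `Set β × Set γ` and the up-set families -/

/-- Membership in `finsetEquivSet.symm S` is membership in `S`. [folklore] -/
theorem mem_finsetEquivSet_symm {α : Type} [Fintype α] (S : Set α) (a : α) : a ∈ Fintype.finsetEquivSet.symm S ↔ a ∈ S := by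
  have h : ((Fintype.finsetEquivSet.symm S : Finset α) : Set α) = S := Fintype.finsetEquivSet.apply_symm_apply S
  rw [← Finset.mem_coe, h]

/-- **The five-up-set inequality on `(Set β × Set γ, (compl, compl))`** from the one-cube conjecture, by transport along
`Set β × Set γ ≃o Finset β × Finset γ` (`Set.toFinset` on each factor). [this work] -/
theorem fiveUpSetIneqOn_setProd (h5 : FiveUpSet.FiveUpSetIneq) (β γ : Type) [Fintype β] [Fintype γ] :
    FiveUpSetIneqOn (Set β × Set γ) ((boolCompl (Set β)).prodCongr (boolCompl (Set γ))) := by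
  let e₁ : Set β ≃o Finset β := (Fintype.finsetOrderIsoSet (α := β)).symm
  let e₂ : Set γ ≃o Finset γ := (Fintype.finsetOrderIsoSet (α := γ)).symm
  let e : (Set β × Set γ) ≃o (Finset β × Finset γ) :=
    { toFun := fun w => (e₁ w.1, e₂ w.2)
      invFun := fun w => (e₁.symm w.1, e₂.symm w.2)
      left_inv := fun w => by simp
      right_inv := fun w => by simp
      map_rel_iff' := by
        intro a b
        simp only [Equiv.coe_fn_mk, Prod.le_def, OrderIso.le_iff_le] }
  refine fiveUpSetIneqOn_of_orderIso e _ (prodCompl β γ) (fun x => ?_) (fiveUpSetIneqOn_prod h5 β γ)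
  have h1 : ∀ (S : Set β) (a : β), a ∈ e₁ S ↔ a ∈ S := fun S a => by
    simp only [e₁, Fintype.coe_finsetOrderIsoSet_symm, mem_finsetEquivSet_symm]
  have h2 : ∀ (S : Set γ) (a : γ), a ∈ e₂ S ↔ a ∈ S := fun S a => by
    simp only [e₂, Fintype.coe_finsetOrderIsoSet_symm, mem_finsetEquivSet_symm]
  ext a
  · simp only [e, RelIso.coe_fn_mk, Equiv.coe_fn_mk, Equiv.prodCongr_apply, Prod.map, boolCompl_apply, prodCompl_apply,
      Finset.mem_compl, h1, Set.mem_compl_iff]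
  · simp only [e, RelIso.coe_fn_mk, Equiv.coe_fn_mk, Equiv.prodCongr_apply, Prod.map, boolCompl_apply, prodCompl_apply,
      Finset.mem_compl, h2, Set.mem_compl_iff]

section UpSets

variable {P Q : Set ι}

omit [Fintype ι] in
/-- Monotonicity of the named configuration in the lattice point. [folklore] -/
theorem image_val_mono {y y' : Set ↥P} (h : y ≤ y') : Subtype.val '' y ⊆ Subtype.val '' y' := Set.image_mono h

/-- `famH` of an increasing event is an up-set of the lattice. [this work] -/
theorem isUpperSet_famH {A : Set (Set ι)} (hA : IsUpperSet A) (O : Set ι) :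
    IsUpperSet ((famH A O P Q : Finset (Set ↥P × Set ↥Q)) : Set (Set ↥P × Set ↥Q)) := by
  intro w w' hww' hw
  rw [mem_coe, mem_famH] at hw ⊢
  refine hA ?_ hw
  exact Set.union_subset_union (Set.union_subset_union_right _ (image_val_mono hww'.1)) (image_val_mono hww'.2)

/-- `famF` of an increasing event is an up-set of the lattice. [this work] -/
theorem isUpperSet_famF {A : Set (Set ι)} (hA : IsUpperSet A) (O x : Set ι) :
    IsUpperSet ((famF A O x P Q : Finset (Set ↥P × Set ↥Q)) : Set (Set ↥P × Set ↥Q)) := by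
  intro w w' hww' hw
  rw [mem_coe, mem_famF] at hw ⊢
  exact hA (Set.union_subset_union_right _ (image_val_mono hww'.1)) hw

/-- `famG` of an increasing event is an up-set of the lattice. [this work] -/
theorem isUpperSet_famG {A : Set (Set ι)} (hA : IsUpperSet A) (O x : Set ι) :
    IsUpperSet ((famG A O x P Q : Finset (Set ↥P × Set ↥Q)) : Set (Set ↥P × Set ↥Q)) := by
  intro w w' hww' hw
  rw [mem_coe, mem_famG] at hw ⊢
  exact hA (Set.union_subset_union_right _ (image_val_mono hww'.2)) hw

/-- `famF` is monotone in `x` for an increasing event. [this work] -/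
theorem famF_mono {A : Set (Set ι)} (hA : IsUpperSet A) (O : Set ι) {x x' : Set ι} (h : x ⊆ x') :
    famF A O x P Q ⊆ famF A O x' P Q := by
  intro w hw
  rw [mem_famF] at hw ⊢
  exact hA (Set.union_subset_union_left _ (Set.union_subset_union_right _ h)) hw

/-- `famG` is monotone in `x` for an increasing event. [this work] -/
theorem famG_mono {A : Set (Set ι)} (hA : IsUpperSet A) (O : Set ι) {x x' : Set ι} (h : x ⊆ x') :
    famG A O x P Q ⊆ famG A O x' P Q := by
  intro w hw
  rw [mem_famG] at hw ⊢
  exact hA (Set.union_subset_union_left _ (Set.union_subset_union_right _ h)) hw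

end UpSets

end SahiHybrid

end Summit.CriticalPhenomena.PercolationContinuityZ3.Theorems
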